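import Literature.Analysis.Approximation.TuranNazarov
import Mathlib.Analysis.SpecialFunctions.Pow.Real
import Mathlib.Analysis.Complex.Trigonometric
import Mathlib.Data.Nat.Choose.Sum
import HarnessLib

/-!
# Turán–Nazarov inequality: proofs (towards `TuranNazarov.lemma_holds`)

This file works towards DISCHARGING the named fact
`Literature.Analysis.Approximation.TuranNazarov.lemma` (the measurable Turán–Nazarov inequality,
Nazarov 1993 [Nazarov1993LocalEstimates], stated as Thm 1.1 of Friedland–Yomdin
[FriedlandYomdin2011TuranNazarov]) by formalizing the modular proof of
O. Friedland, *A disk-growth Remez principle and a modular proof of the measurable Turán–Nazarov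
inequality*, arXiv:2606.24823 (2026) [Friedland2026DiskGrowthRemez], whose ONLY Turán-type input
is the classical interval Turán inequality.  Theorems only: no definitions, no named facts.

## Road map (Friedland 2026), and what is here so far

1. (§3, Thm 3.1) classical interval Turán inequality — `turan_interval` (PROVED here, Part 1);
2. (Lemma 3.2) interval Turán ⟹ disk growth — `disk_growth` (PROVED here, Part 1);
3. (App. B, Lemma B.2) weak Cauchy estimate `|{x : |∑ 1/(x-ζ_j)| > y}| ≤ CN/y` (harmonic-measure
   argument through the Cayley transform and the mean value property; no Hilbert transform);
4. (App. A, Lemma A.3) zero-free quotient: Harnack + Borel–Carathéodory + Cauchy estimate;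
5. (A.1–A.2, B.1, Prop 2.1) Blaschke bookkeeping via Mathlib's canonical decomposition, disc zero
   counting, effective zero product;
6. (A.4, Prop 2.2, Thm 1.1) Cartan covering on the line, sublevel estimate, disk-growth Remez;
7. (Lemmas 4.1–4.3) weak logarithmic derivative and large-diameter pruning;
8. (Lemma 3.3, Cor 3.4, Thm 5.1, Thm 1.2, Cor 1.3) geometric-mean induction on the order and the
   conversion to the `Fin (m+1)`-indexed statement `TuranNazarov.lemma`.

## Part 1 — the classical interval Turán inequality and disk growth

* `newton_expansion`: `x^N = ∑_{i ≤ N} a_i ∏_{l<i} (x - u_l)` with `‖a_i‖ ≤ C(N,i)` for nodes of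
  norm `≤ 1` (Pascal recursion `a_{N+1,i} = a_{N,i-1} + u_i a_{N,i}`; the `a_i` are complete
  homogeneous symmetric polynomials of the nodes).
* `turan_power_sums` — **Turán's first main theorem** in the de Bruijn–Newton form with the SHARP
  exponent: for `‖w_k‖ ≥ 1`, `s_ν = ∑_k b_k w_k^ν`,
  `‖s_0‖ ≤ (∑_{i<n} C(m+n,i) 2^i) · max_{m+1≤ν≤m+n} ‖s_ν‖`.
  Proof: evaluate the Newton expansion of `x^{m+n}` at the nodes `u_k = 1/w_k`; the products
  `∏_{l<i}(u_k - u_l) = u_k^i ∏_{l<i}(1 - u_l w_k)` expand into `2^i` signed power sums with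
  indices in `[m+1, m+n]`.
* `sum_choose_le` (`∑_{i≤r} C(N,i) ≤ (eN/r)^r`), `turan_coeff_le` (the coefficient is
  `≤ (4eK)^{n-1}` once `m+n ≤ nK`).
* `turan_interval_right`, `turan_interval` — **Thm 3.1**: for `p(x) = ∑_{k∈s} c_k e^{μ_k x}`,
  `n = #s`, `|Re μ_k| ≤ M`, `J = [α, α+ℓ] ⊆ [A, B]`:
  `‖p(t)‖ ≤ e^{M(B-A)} (4e (B-A)/ℓ)^{n-1} S` for all `t ∈ [A,B]` whenever `‖p‖ ≤ S` on `J`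
  (arithmetic progression `t - νh`, `h = ℓ/n`, `ν = m+1,…,m+n` inside `J`, exponents shifted by
  `M`; reflection `x ↦ -x` for `t` left of `J`).  Constant `4e`; exponent `n - 1` (sharp).
* `disk_growth` — **Lemma 3.2**: `‖μ_k‖ ≤ σ`, `0 < r ≤ R`:
  `sup_{D̄(z₀,R)} |q| ≤ e^{2Rσ} (4eR/r)^{n-1} sup_{D̄(z₀,r)} |q|` (closed discs, pointwise form).

Exponential polynomials are kept as explicit Finset sums `∑ k ∈ s, c k * cexp (μ k * z)` (terms
need not have distinct exponents; `n` is the number of terms), the shape of `TuranNazarov.lemma`.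
-/

noncomputable section

open Finset Complex

namespace Literature.Analysis.Approximation

namespace TuranNazarov

/-- Newton expansion of `x ^ N` with respect to an arbitrary sequence of nodes `u 0, u 1, …` of
norm `≤ 1`: `x ^ N = ∑_{i ≤ N} a i · ∏_{l < i} (x - u l)` with `‖a i‖ ≤ N.choose i` (the `a i` are the
complete homogeneous symmetric polynomials `h_{N-i}(u 0, …, u i)`; Pascal-type recursion). [folklore] -/
theorem newton_expansion (u : ℕ → ℂ) (hu : ∀ l, ‖u l‖ ≤ 1) (N : ℕ) :
    ∃ a : ℕ → ℂ, (∀ i, ‖a i‖ ≤ (N.choose i : ℝ)) ∧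
      ∀ x : ℂ, x ^ N = ∑ i ∈ range (N + 1), a i * ∏ l ∈ range i, (x - u l) := by
  induction N with
  | zero =>
    refine ⟨fun i => if i = 0 then 1 else 0, fun i => ?_, fun x => by simp⟩
    rcases Nat.eq_zero_or_pos i with rfl | hi
    · simp
    · simp [hi.ne']
  | succ N ih =>
    obtain ⟨a, ha, hax⟩ := ih
    refine ⟨fun i => (if i = 0 then 0 else a (i - 1)) + u i * a i, fun i => ?_, fun x => ?_⟩
    · rcases Nat.eq_zero_or_pos i with rfl | hi
      · have := ha 0
        calc ‖(if (0:ℕ) = 0 then (0:ℂ) else a (0 - 1)) + u 0 * a 0‖ = ‖u 0‖ * ‖a 0‖ := by simp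
          _ ≤ 1 * (N.choose 0 : ℝ) := by gcongr; exact hu 0
          _ = ((N + 1).choose 0 : ℝ) := by simp
      · obtain ⟨j, rfl⟩ : ∃ j, i = j + 1 := ⟨i - 1, by omega⟩
        calc ‖(if j + 1 = 0 then (0:ℂ) else a (j + 1 - 1)) + u (j + 1) * a (j + 1)‖
            ≤ ‖a j‖ + ‖u (j + 1)‖ * ‖a (j + 1)‖ := by
              simpa using norm_add_le (a j) (u (j + 1) * a (j + 1))
          _ ≤ (N.choose j : ℝ) + 1 * (N.choose (j + 1) : ℝ) := by
              gcongr
              · exact ha j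
              · exact hu (j + 1)
              · exact ha (j + 1)
          _ = ((N + 1).choose (j + 1) : ℝ) := by
              rw [Nat.choose_succ_succ']; push_cast; ring
    · -- the identity
      have hvan : a (N + 1) = 0 := by
        have := ha (N + 1)
        simpa using this
      have key : ∀ i, x * ∏ l ∈ range i, (x - u l) =
          ∏ l ∈ range (i + 1), (x - u l) + u i * ∏ l ∈ range i, (x - u l) := by
        intro i
        rw [prod_range_succ]; ring
      calc x ^ (N + 1) = x * x ^ N := by ring
        _ = ∑ i ∈ range (N + 1), a i * (x * ∏ l ∈ range i, (x - u l)) := by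
            rw [hax x, mul_sum]; refine sum_congr rfl fun i _ => by ring
        _ = ∑ i ∈ range (N + 1), a i * ∏ l ∈ range (i + 1), (x - u l) +
              ∑ i ∈ range (N + 1), u i * a i * ∏ l ∈ range i, (x - u l) := by
            rw [← sum_add_distrib]; refine sum_congr rfl fun i _ => by rw [key]; ring
        _ = ∑ i ∈ range (N + 2), (if i = 0 then 0 else a (i - 1)) * ∏ l ∈ range i, (x - u l) +
              ∑ i ∈ range (N + 2), u i * a i * ∏ l ∈ range i, (x - u l) := by
            congr 1
            · rw [sum_range_succ' _ (N + 1)]; simp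
            · rw [sum_range_succ _ (N + 1), hvan]; simp
        _ = ∑ i ∈ range (N + 1 + 1),
              ((if i = 0 then 0 else a (i - 1)) + u i * a i) * ∏ l ∈ range i, (x - u l) := by
            rw [← sum_add_distrib]; refine sum_congr rfl fun i _ => by ring

/-- Partial sums of binomial coefficients: `∑_{i ≤ r} C(N, i) ≤ (e N / r)^r` for `1 ≤ r ≤ N`.
[folklore] -/
theorem sum_choose_le {N r : ℕ} (hr : 1 ≤ r) (hrN : r ≤ N) :
    ∑ i ∈ range (r + 1), (N.choose i : ℝ) ≤ (Real.exp 1 * N / r) ^ r := by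
  have hr0 : (0 : ℝ) < r := by exact_mod_cast hr
  have hN0 : (0 : ℝ) < N := by exact_mod_cast (lt_of_lt_of_le hr hrN)
  set x : ℝ := r / N with hx
  have hx0 : 0 < x := div_pos hr0 hN0
  have hx1 : x ≤ 1 := by rw [hx, div_le_one hN0]; exact_mod_cast hrN
  -- each term: C(N,i) ≤ C(N,i) x^i / x^r
  have hterm : ∀ i ∈ range (r + 1), (N.choose i : ℝ) ≤ (N.choose i : ℝ) * x ^ i / x ^ r := by
    intro i hi
    rw [mem_range] at hi
    rw [le_div_iff₀ (pow_pos hx0 r)]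
    have : x ^ r ≤ x ^ i := pow_le_pow_of_le_one hx0.le hx1 (by omega)
    calc (N.choose i : ℝ) * x ^ r ≤ (N.choose i : ℝ) * x ^ i := by gcongr
      _ = (N.choose i : ℝ) * x ^ i := rfl
  calc ∑ i ∈ range (r + 1), (N.choose i : ℝ)
      ≤ ∑ i ∈ range (r + 1), (N.choose i : ℝ) * x ^ i / x ^ r := sum_le_sum hterm
    _ = (∑ i ∈ range (r + 1), (N.choose i : ℝ) * x ^ i) / x ^ r := by rw [sum_div]
    _ ≤ (∑ i ∈ range (N + 1), (N.choose i : ℝ) * x ^ i) / x ^ r := by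
        gcongr
    _ = (1 + x) ^ N / x ^ r := by
        congr 1
        rw [show (1 : ℝ) + x = x + 1 by ring, add_pow]
        refine sum_congr rfl fun i _ => by simp [mul_comm]
    _ ≤ Real.exp x ^ N / x ^ r := by
        gcongr
        linarith [Real.add_one_le_exp x]
    _ = (Real.exp 1 * N / r) ^ r := by
        have h1 : Real.exp x ^ N = Real.exp 1 ^ r := by
          rw [← Real.exp_nat_mul, ← Real.exp_nat_mul]
          congr 1
          rw [hx]; field_simp
        rw [h1, ← div_pow]
        congr 1
        rw [hx]; field_simp

/-- **Turán's first main theorem** on power sums, in the de Bruijn–Newton form with the sharp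
exponent: if `‖w k‖ ≥ 1` for all `k` then
`‖∑ b k‖ ≤ (∑_{i<n} C(m+n,i) 2^i) · max_{m+1 ≤ ν ≤ m+n} ‖∑_k b k (w k)^ν‖`.
(Turán 1953; this coefficient bookkeeping follows the Newton expansion of `x^{m+n}` at the
nodes `1/w k`.) [cite: Turan1984NewMethod, Sec. 6 Thm. 6.1 (first main theorem)] -/
theorem turan_power_sums {n : ℕ} (w b : Fin n → ℂ) (hw : ∀ k, 1 ≤ ‖w k‖) (m : ℕ) {S : ℝ}
    (hS : ∀ ν : ℕ, m + 1 ≤ ν → ν ≤ m + n → ‖∑ k, b k * w k ^ ν‖ ≤ S) :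
    ‖∑ k, b k‖ ≤ (∑ i ∈ range n, ((m + n).choose i : ℝ) * 2 ^ i) * S := by
  rcases Nat.eq_zero_or_pos n with rfl | hn
  · simp
  have hw0 : ∀ k, w k ≠ 0 := fun k h => by have := hw k; rw [h, norm_zero] at this; linarith
  -- nodes `u l = (w l)⁻¹`, extended by `0`
  set u : ℕ → ℂ := fun l => if h : l < n then (w ⟨l, h⟩)⁻¹ else 0 with hu_def
  have hu : ∀ l, ‖u l‖ ≤ 1 := by
    intro l
    by_cases h : l < n
    · simp only [hu_def, h, dif_pos, norm_inv]
      exact inv_le_one_of_one_le₀ (hw ⟨l, h⟩)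
    · simp [hu_def, h]
  have huk : ∀ k : Fin n, u k = (w k)⁻¹ := fun k => by simp [hu_def, k.2]
  have huw : ∀ k : Fin n, u k * w k = 1 := fun k => by rw [huk, inv_mul_cancel₀ (hw0 k)]
  set N := m + n with hN
  obtain ⟨a, ha, hax⟩ := newton_expansion u hu N
  -- Newton expansion at the node `u k`, truncated to `i < n` (the later terms vanish at `u k`)
  have hroot : ∀ k : Fin n, (u k) ^ N = ∑ i ∈ range n, a i * ∏ l ∈ range i, (u k - u l) := by
    intro k
    rw [hax (u k)]
    symm
    apply sum_subset (range_mono (by omega))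
    intro i _ hin
    have hik : (k : ℕ) ∈ range i := by simp only [mem_range, not_lt] at hin ⊢; omega
    rw [prod_eq_zero hik (by simp), mul_zero]
  -- the inner sums are signed combinations of at most `2^i` of the controlled power sums
  have hT : ∀ i ∈ range n, ‖∑ k, b k * w k ^ N * ∏ l ∈ range i, (u k - u l)‖ ≤ 2 ^ i * S := by
    intro i hi
    rw [mem_range] at hi
    have hiN : i ≤ N := by omega
    have hfac : ∀ k : Fin n, w k ^ N * ∏ l ∈ range i, (u k - u l) =
        ∑ t ∈ (range i).powerset, (∏ l ∈ t, (-u l)) * w k ^ (N - i + t.card) := by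
      intro k
      have h1 : ∀ l, u k - u l = u k * (1 + (-u l) * w k) := fun l => by
        linear_combination (u l) * huw k
      have h2 : w k ^ (N - i + i) * u k ^ i = w k ^ (N - i) := by
        rw [pow_add, mul_assoc, ← mul_pow, mul_comm (w k) (u k), huw, one_pow, mul_one]
      rw [Nat.sub_add_cancel hiN] at h2
      rw [prod_congr rfl fun l _ => h1 l, prod_mul_distrib, prod_const, card_range, prod_one_add,
        ← mul_assoc, h2, mul_sum]
      refine sum_congr rfl fun t _ => ?_
      rw [prod_mul_distrib, prod_const, pow_add]
      ring
    calc ‖∑ k, b k * w k ^ N * ∏ l ∈ range i, (u k - u l)‖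
        = ‖∑ t ∈ (range i).powerset, (∏ l ∈ t, (-u l)) * ∑ k, b k * w k ^ (N - i + t.card)‖ := by
          congr 1
          simp_rw [mul_assoc, hfac, mul_sum]
          rw [sum_comm]
          refine sum_congr rfl fun t _ => sum_congr rfl fun k _ => by ring
      _ ≤ ∑ t ∈ (range i).powerset, ‖(∏ l ∈ t, (-u l)) * ∑ k, b k * w k ^ (N - i + t.card)‖ :=
          norm_sum_le _ _
      _ ≤ ∑ t ∈ (range i).powerset, S := by
          refine sum_le_sum fun t ht => ?_
          rw [norm_mul]
          have hct : ‖∏ l ∈ t, (-u l)‖ ≤ 1 := by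
            rw [norm_prod]
            exact prod_le_one (fun _ _ => norm_nonneg _) (fun l _ => by rw [norm_neg]; exact hu l)
          have hcard : t.card ≤ i := by simpa using card_le_card (mem_powerset.1 ht)
          calc ‖∏ l ∈ t, (-u l)‖ * ‖∑ k, b k * w k ^ (N - i + t.card)‖ ≤ 1 * S := by
                gcongr
                exact hS _ (by omega) (by omega)
            _ = S := one_mul S
      _ = 2 ^ i * S := by simp [card_powerset]
  calc ‖∑ k, b k‖ = ‖∑ k, b k * (w k ^ N * u k ^ N)‖ := by
        congr 1; refine sum_congr rfl fun k _ => ?_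
        rw [← mul_pow, mul_comm (w k), huw, one_pow, mul_one]
    _ = ‖∑ i ∈ range n, a i * ∑ k, b k * w k ^ N * ∏ l ∈ range i, (u k - u l)‖ := by
        congr 1
        simp_rw [hroot, mul_sum]
        rw [sum_comm]
        refine sum_congr rfl fun i _ => sum_congr rfl fun k _ => by ring
    _ ≤ ∑ i ∈ range n, ‖a i * ∑ k, b k * w k ^ N * ∏ l ∈ range i, (u k - u l)‖ := norm_sum_le _ _
    _ ≤ ∑ i ∈ range n, (N.choose i : ℝ) * (2 ^ i * S) := by
        refine sum_le_sum fun i hi => ?_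
        rw [norm_mul]
        have h0 : 0 ≤ 2 ^ i * S :=
          mul_nonneg (by positivity) (le_trans (norm_nonneg _) (hS (m + 1) le_rfl (by omega)))
        gcongr
        · exact ha i
        · exact hT i hi
    _ = (∑ i ∈ range n, (N.choose i : ℝ) * 2 ^ i) * S := by
        rw [sum_mul]; exact sum_congr rfl fun i _ => by ring


/-- The Turán coefficient is at most `(4eK)^{n-1}` as soon as `m + n ≤ nK`. [folklore] -/
theorem turan_coeff_le {n m : ℕ} (hn : 1 ≤ n) {K : ℝ} (hmn : (m + n : ℝ) ≤ n * K) :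
    ∑ i ∈ range n, ((m + n).choose i : ℝ) * 2 ^ i ≤ (4 * Real.exp 1 * K) ^ (n - 1) := by
  obtain ⟨r, rfl⟩ : ∃ r, n = r + 1 := ⟨n - 1, by omega⟩
  simp only [Nat.add_sub_cancel]
  rcases Nat.eq_zero_or_pos r with rfl | hr
  · simp
  have hr1 : (1 : ℝ) ≤ r := by exact_mod_cast hr
  set N := m + (r + 1) with hN
  have hrN : r ≤ N := by omega
  calc ∑ i ∈ range (r + 1), (N.choose i : ℝ) * 2 ^ i
      ≤ ∑ i ∈ range (r + 1), (N.choose i : ℝ) * 2 ^ r := by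
        refine sum_le_sum fun i hi => ?_
        rw [mem_range] at hi
        gcongr
        · norm_num
        · omega
    _ = 2 ^ r * ∑ i ∈ range (r + 1), (N.choose i : ℝ) := by rw [mul_sum]; simp [mul_comm]
    _ ≤ 2 ^ r * (Real.exp 1 * N / r) ^ r := by
        gcongr
        exact sum_choose_le hr hrN
    _ = (2 * (Real.exp 1 * N / r)) ^ r := by rw [mul_pow]
    _ ≤ (4 * Real.exp 1 * K) ^ r := by
        have hNr : (N : ℝ) / r ≤ 2 * K := by
          rw [div_le_iff₀ (by positivity)]
          have h1 : (N : ℝ) ≤ (r + 1) * K := by simpa [hN] using hmn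
          nlinarith
        have : 2 * (Real.exp 1 * N / r) ≤ 4 * Real.exp 1 * K := by
          rw [mul_div_assoc]
          nlinarith [Real.exp_pos 1]
        exact pow_le_pow_left₀ (by positivity) this r

/-- One-sided classical interval Turán inequality: the controlling interval `[α, α+ℓ]` lies to the
left of `t`.  Arithmetic progression `t - νh`, `h = ℓ/n`, `ν = m+1, …, m+n` inside `[α, α+ℓ]`,
exponents shifted by `M` so that the ratios have norm `≥ 1`, then `turan_power_sums`.
[cite: Friedland2026DiskGrowthRemez, Thm 3.1] -/
theorem turan_interval_right {ι : Type*} (s : Finset ι) (c μ : ι → ℂ) {α ℓ M S t : ℝ}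
    (hℓ : 0 < ℓ) (hM : ∀ k ∈ s, (μ k).re ≤ M) (hM0 : 0 ≤ M)
    (hS : ∀ x : ℝ, α ≤ x → x ≤ α + ℓ → ‖∑ k ∈ s, c k * cexp (μ k * x)‖ ≤ S) (ht : α + ℓ < t) :
    ‖∑ k ∈ s, c k * cexp (μ k * t)‖ ≤
      Real.exp (M * (t - α)) * (4 * Real.exp 1 * ((t - α) / ℓ)) ^ (s.card - 1) * S := by
  have hS0 : 0 ≤ S := le_trans (norm_nonneg _) (hS α le_rfl (by linarith))
  set n := s.card with hn_def
  have hKpos : 0 ≤ (t - α) / ℓ := div_nonneg (by linarith) hℓ.le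
  rcases Nat.eq_zero_or_pos n with hn0 | hn
  · have : s = ∅ := card_eq_zero.1 (by omega)
    subst this
    simp only [sum_empty, norm_zero]
    exact mul_nonneg (mul_nonneg (Real.exp_pos _).le (pow_nonneg (by positivity) _)) hS0
  -- the arithmetic progression
  have hn0 : (0 : ℝ) < n := by exact_mod_cast hn
  set h : ℝ := ℓ / n with hh
  have hh0 : 0 < h := div_pos hℓ hn0
  have hnh : (n : ℝ) * h = ℓ := by rw [hh]; field_simp
  set x₀ : ℝ := (t - α - ℓ) / h with hx₀
  have hx₀0 : 0 < x₀ := div_pos (by linarith) hh0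
  set m : ℕ := ⌈x₀⌉₊ - 1 with hm
  have hm1 : ((m + 1 : ℕ) : ℝ) = ⌈x₀⌉₊ := by
    have : 1 ≤ ⌈x₀⌉₊ := Nat.lt_ceil.2 (by simpa using hx₀0)
    rw [hm]; norm_cast; omega
  have hlow : t - α - ℓ ≤ (m + 1 : ℕ) * h := by
    rw [hm1]
    calc t - α - ℓ = x₀ * h := by rw [hx₀]; field_simp
      _ ≤ ⌈x₀⌉₊ * h := by gcongr; exact Nat.le_ceil x₀
  have hup : ((m + n : ℕ) : ℝ) * h < t - α := by
    have h1 : ((m + n : ℕ) : ℝ) = ⌈x₀⌉₊ - 1 + n := by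
      push_cast
      have : ((m : ℕ) : ℝ) = ((m + 1 : ℕ) : ℝ) - 1 := by push_cast; ring
      rw [this, hm1]
    have h2 : (⌈x₀⌉₊ : ℝ) < x₀ + 1 := Nat.ceil_lt_add_one hx₀0.le
    calc ((m + n : ℕ) : ℝ) * h < (x₀ + n) * h := by rw [h1]; gcongr; linarith
      _ = t - α := by rw [add_mul, hnh, hx₀]; field_simp; ring
  have hAP : ∀ ν : ℕ, m + 1 ≤ ν → ν ≤ m + n → α ≤ t - ν * h ∧ t - ν * h ≤ α + ℓ := by
    intro ν h1 h2
    have h1' : ((m + 1 : ℕ) : ℝ) ≤ ν := by exact_mod_cast h1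
    have h2' : (ν : ℝ) ≤ ((m + n : ℕ) : ℝ) := by exact_mod_cast h2
    constructor
    · nlinarith
    · nlinarith
  -- enumerate `s` and set up the power sums
  set e := s.equivFin with he
  set w : Fin n → ℂ := fun j => cexp (((M : ℂ) - μ (e.symm j)) * h) with hw_def
  set b : Fin n → ℂ := fun j => c (e.symm j) * cexp (μ (e.symm j) * t) with hb_def
  have hw : ∀ j, 1 ≤ ‖w j‖ := by
    intro j
    simp only [hw_def, Complex.norm_exp]
    apply Real.one_le_exp
    have : (((M : ℂ) - μ (e.symm j)) * h).re = (M - (μ (e.symm j)).re) * h := by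
      simp [Complex.sub_re, Complex.mul_re]
    rw [this]
    exact mul_nonneg (by linarith [hM _ (e.symm j).2]) hh0.le
  have hsum : ∀ f : ι → ℂ, ∑ j : Fin n, f (e.symm j) = ∑ k ∈ s, f k := by
    intro f
    rw [Equiv.sum_comp e.symm (fun x : s => f x), sum_coe_sort]
  have hpow : ∀ ν : ℕ, ∑ j, b j * w j ^ ν =
      cexp ((M : ℂ) * (ν * h)) * ∑ k ∈ s, c k * cexp (μ k * ((t - ν * h : ℝ) : ℂ)) := by
    intro ν
    rw [mul_sum, ← hsum]
    refine Fintype.sum_congr _ _ fun j => ?_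
    simp only [hb_def, hw_def]
    rw [← Complex.exp_nat_mul, mul_assoc, ← Complex.exp_add]
    have : cexp (↑M * (↑ν * ↑h)) * (c ↑(e.symm j) * cexp (μ ↑(e.symm j) * ((t - ν * h : ℝ) : ℂ))) =
        c ↑(e.symm j) * (cexp (↑M * (↑ν * ↑h)) * cexp (μ ↑(e.symm j) * ((t - ν * h : ℝ) : ℂ))) := by
      ring
    rw [this, ← Complex.exp_add]
    congr 2
    push_cast
    ring
  have hSν : ∀ ν : ℕ, m + 1 ≤ ν → ν ≤ m + n →
      ‖∑ j, b j * w j ^ ν‖ ≤ Real.exp (M * (t - α)) * S := by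
    intro ν h1 h2
    obtain ⟨hl, hr⟩ := hAP ν h1 h2
    rw [hpow, norm_mul, Complex.norm_exp]
    have hre : ((M : ℂ) * (ν * h)).re = M * (ν * h) := by
      simp [Complex.mul_re]
    rw [hre]
    gcongr
    · have : (ν : ℝ) * h ≤ ((m + n : ℕ) : ℝ) * h := by gcongr
      linarith
    · exact hS _ hl hr
  have key := turan_power_sums w b hw m hSν
  have hb0 : ∑ j, b j = ∑ k ∈ s, c k * cexp (μ k * t) := hsum (fun k => c k * cexp (μ k * t))
  rw [hb0] at key
  -- the Turán coefficient
  have hmn : ((m + n : ℕ) : ℝ) ≤ n * ((t - α) / ℓ) := by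
    have : (n : ℝ) * ((t - α) / ℓ) = (t - α) / h := by rw [hh]; field_simp
    rw [this, le_div_iff₀ hh0]
    exact hup.le
  have hcoef := turan_coeff_le (m := m) hn (by exact_mod_cast hmn)
  calc ‖∑ k ∈ s, c k * cexp (μ k * t)‖
      ≤ (∑ i ∈ range n, ((m + n).choose i : ℝ) * 2 ^ i) * (Real.exp (M * (t - α)) * S) := key
    _ ≤ (4 * Real.exp 1 * ((t - α) / ℓ)) ^ (n - 1) * (Real.exp (M * (t - α)) * S) := by
        gcongr
    _ = Real.exp (M * (t - α)) * (4 * Real.exp 1 * ((t - α) / ℓ)) ^ (n - 1) * S := by ring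

/-- **Classical interval Turán inequality** (Turán's lemma for exponential sums with complex
exponents, the form recorded as Friedland 2026, Thm 3.1): for an exponential polynomial
`p(x) = ∑_{k ∈ s} c_k e^{μ_k x}` with `n = #s` terms and `|Re μ_k| ≤ M`, and intervals
`J = [α, α+ℓ] ⊆ K = [A, B]`,  `sup_K |p| ≤ e^{M |K|} (4e |K|/|J|)^{n-1} sup_J |p|`
(pointwise form: any bound `S` for `|p|` on `J` bounds `|p|` on `K` after the factor).
[cite: Friedland2026DiskGrowthRemez, Thm 3.1] [cite: Turan1984NewMethod, Sec. 6 Thm. 6.1 (first main theorem)] -/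
theorem turan_interval {ι : Type*} (s : Finset ι) (c μ : ι → ℂ) {A B α ℓ M S : ℝ}
    (hℓ : 0 < ℓ) (hAα : A ≤ α) (hαB : α + ℓ ≤ B) (hM : ∀ k ∈ s, |(μ k).re| ≤ M)
    (hS : ∀ x : ℝ, α ≤ x → x ≤ α + ℓ → ‖∑ k ∈ s, c k * cexp (μ k * x)‖ ≤ S)
    {t : ℝ} (hAt : A ≤ t) (htB : t ≤ B) :
    ‖∑ k ∈ s, c k * cexp (μ k * t)‖ ≤
      Real.exp (M * (B - A)) * (4 * Real.exp 1 * ((B - A) / ℓ)) ^ (s.card - 1) * S := by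
  have hS0 : 0 ≤ S := le_trans (norm_nonneg _) (hS α le_rfl (by linarith))
  have hKpos : 0 ≤ (B - A) / ℓ := div_nonneg (by linarith) hℓ.le
  rcases s.eq_empty_or_nonempty with rfl | hne
  · simp only [sum_empty, norm_zero]
    exact mul_nonneg (mul_nonneg (Real.exp_pos _).le (pow_nonneg (by positivity) _)) hS0
  obtain ⟨k₀, hk₀⟩ := hne
  have hM0 : 0 ≤ M := le_trans (abs_nonneg _) (hM k₀ hk₀)
  have hbase : 1 ≤ 4 * Real.exp 1 * ((B - A) / ℓ) := by
    have h1 : 1 ≤ (B - A) / ℓ := by rw [le_div_iff₀ hℓ]; linarith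
    have h2 : (1 : ℝ) ≤ Real.exp 1 := Real.one_le_exp zero_le_one
    nlinarith
  -- monotonicity of the right-hand side in the length parameter
  have hmono : ∀ L : ℝ, 0 ≤ L → L ≤ B - A →
      Real.exp (M * L) * (4 * Real.exp 1 * (L / ℓ)) ^ (s.card - 1) * S ≤
        Real.exp (M * (B - A)) * (4 * Real.exp 1 * ((B - A) / ℓ)) ^ (s.card - 1) * S := by
    intro L hL0 hL
    gcongr
  rcases le_or_gt α t with hαt | htα
  · rcases le_or_gt t (α + ℓ) with htJ | htJ
    · -- `t ∈ J`
      calc ‖∑ k ∈ s, c k * cexp (μ k * t)‖ ≤ S := hS t hαt htJ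
        _ = 1 * 1 * S := by ring
        _ ≤ Real.exp (M * (B - A)) * (4 * Real.exp 1 * ((B - A) / ℓ)) ^ (s.card - 1) * S := by
            gcongr
            · exact Real.one_le_exp (by nlinarith)
            · exact one_le_pow₀ hbase
    · -- `t` to the right of `J`
      have h := turan_interval_right s c μ hℓ (fun k hk => (abs_le.1 (hM k hk)).2) hM0 hS htJ
      exact h.trans (hmono (t - α) (by linarith) (by linarith))
  · -- `t` to the left of `J`: reflect `x ↦ -x`
    have hS' : ∀ x : ℝ, -(α + ℓ) ≤ x → x ≤ -(α + ℓ) + ℓ →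
        ‖∑ k ∈ s, c k * cexp (-μ k * x)‖ ≤ S := by
      intro x h1 h2
      have h3 := hS (-x) (by linarith) (by linarith)
      have heq : ∑ k ∈ s, c k * cexp (-μ k * (x : ℂ)) = ∑ k ∈ s, c k * cexp (μ k * ((-x : ℝ) : ℂ)) := by
        refine sum_congr rfl fun k _ => ?_
        congr 2
        push_cast
        ring
      rwa [heq]
    have hM' : ∀ k ∈ s, (-μ k).re ≤ M := by
      intro k hk
      have := (abs_le.1 (hM k hk)).1
      simp only [Complex.neg_re]
      linarith
    have h := turan_interval_right s c (fun k => -μ k) hℓ hM' hM0 hS' (t := -t) (by linarith)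
    have heq : ∑ k ∈ s, c k * cexp (-μ k * ((-t : ℝ) : ℂ)) = ∑ k ∈ s, c k * cexp (μ k * t) := by
      refine sum_congr rfl fun k _ => ?_
      congr 2
      push_cast
      ring
    rw [heq] at h
    exact h.trans (hmono (-t - -(α + ℓ)) (by linarith) (by linarith))

/-- **Interval Turán implies disk growth** (Friedland 2026, Lemma 3.2): for an exponential
polynomial `q(z) = ∑_{k∈s} a_k e^{μ_k z}` with `n` terms and `‖μ_k‖ ≤ σ`, every centre `z₀` and
radii `0 < r ≤ R`:  `sup_{D̄(z₀,R)} |q| ≤ e^{2Rσ} (4e R/r)^{n-1} sup_{D̄(z₀,r)} |q|` — the interval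
inequality `turan_interval` along the ray from `z₀` through `z`. (Closed discs, pointwise form.)
[cite: Friedland2026DiskGrowthRemez, Lemma 3.2] -/
theorem disk_growth {ι : Type*} (s : Finset ι) (a μ : ι → ℂ) {σ : ℝ} (hσ : ∀ k ∈ s, ‖μ k‖ ≤ σ)
    (z₀ : ℂ) {r R S : ℝ} (hr : 0 < r) (hrR : r ≤ R)
    (hS : ∀ ζ ∈ Metric.closedBall z₀ r, ‖∑ k ∈ s, a k * cexp (μ k * ζ)‖ ≤ S)
    {z : ℂ} (hz : z ∈ Metric.closedBall z₀ R) :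
    ‖∑ k ∈ s, a k * cexp (μ k * z)‖ ≤
      Real.exp (σ * (2 * R)) * (4 * Real.exp 1 * (R / r)) ^ (s.card - 1) * S := by
  set s₀ : ℝ := ‖z - z₀‖ with hs₀
  have hs₀R : s₀ ≤ R := by simpa [hs₀, dist_eq_norm] using hz
  set θ : ℂ := (z - z₀) / (s₀ : ℂ) with hθ
  have hθ1 : ‖θ‖ ≤ 1 := by
    rw [hθ, norm_div, Complex.norm_real, Real.norm_eq_abs, abs_of_nonneg (norm_nonneg _), ← hs₀]
    exact div_self_le_one s₀
  have hzθ : z = z₀ + (s₀ : ℂ) * θ := by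
    rcases eq_or_ne s₀ 0 with h0 | h0
    · have : z - z₀ = 0 := by simpa [hs₀] using h0
      rw [h0]; simp; linear_combination this
    · rw [hθ, mul_div_cancel₀ _ (by exact_mod_cast h0)]; ring
  -- the exponential polynomial along the ray
  set c' : ι → ℂ := fun k => a k * cexp (μ k * z₀) with hc'
  set μ' : ι → ℂ := fun k => μ k * θ with hμ'
  have hray : ∀ x : ℝ, ∑ k ∈ s, c' k * cexp (μ' k * x) =
      ∑ k ∈ s, a k * cexp (μ k * (z₀ + x * θ)) := by
    intro x
    refine sum_congr rfl fun k _ => ?_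
    simp only [hc', hμ']
    rw [mul_assoc, ← Complex.exp_add]
    congr 2
    ring
  have hM : ∀ k ∈ s, |(μ' k).re| ≤ σ := by
    intro k hk
    calc |(μ' k).re| ≤ ‖μ' k‖ := Complex.abs_re_le_norm _
      _ = ‖μ k‖ * ‖θ‖ := norm_mul _ _
      _ ≤ σ * 1 := by
          gcongr
          · exact le_trans (norm_nonneg _) (hσ k hk)
          · exact hσ k hk
      _ = σ := mul_one σ
  have hS' : ∀ x : ℝ, -r ≤ x → x ≤ -r + 2 * r → ‖∑ k ∈ s, c' k * cexp (μ' k * x)‖ ≤ S := by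
    intro x h1 h2
    rw [hray]
    apply hS
    rw [Metric.mem_closedBall, dist_eq_norm, add_sub_cancel_left, norm_mul, Complex.norm_real,
      Real.norm_eq_abs]
    calc |x| * ‖θ‖ ≤ r * 1 := by gcongr; rw [abs_le]; constructor <;> linarith
      _ = r := mul_one r
  have key := turan_interval s c' μ' (A := -R) (B := R) (α := -r) (ℓ := 2 * r) (M := σ) (S := S)
    (t := s₀) (by linarith) (by linarith) (by linarith) hM hS' (by linarith [norm_nonneg (z - z₀)])
    hs₀R
  rw [hray, ← hzθ] at key
  convert key using 4 <;> ring


end TuranNazarov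

end Literature.Analysis.Approximation
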